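import Literature.MathematicalPhysics.QuantumManyBody.PeriodicConfigFourier
import HarnessLib

/-!
# The Poincaré–Wirtinger inequality on the torus cells `[0,L)³` and `[0,L)^{3N}` (free-gas spectral gap)

Topic `Literature/MathematicalPhysics/QuantumManyBody` (companion of `PeriodicBoseGasFourier.lean`, the
one-particle cell Fourier layer, and `PeriodicConfigFourier.lean`, its `N`-body version; helper for the
registered stub `stub_nearMinimiserRigidity` of crux `CorrectorClosure`, stmt-AtomisticToContinuum-12058,
line `llp-fidelity-arc`, where it is the free-gas (`v = 0`) mechanism of rigidity of near-minimisers: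
on the torus the kinetic energy controls the distance to the constant mode). Theorems only.

**One particle.** For a `C¹`, `Lℤ³`-periodic `φ : ℝ³ → ℂ` with cell Fourier coefficients `ĉₙ(φ)`,
`n ∈ ℤ³` (`cellFourierCoeff`; `ĉ₀(φ) = L⁻³ ∫_{[0,L)³} φ`, `cellFourierCoeff_zero`), every non-zero
mode has `|2πn/L|² ≥ (2π/L)²` (`one_le_sq_mul_modeWeight`), so Parseval (`tsum_sq_cellFourierCoeff`)
and Parseval for the gradient (`tsum_sq_grad_cellFourierCoeff`) give
* `lintegral_cell_normSq_le` (projection form): `∫_{[0,L)³} |φ|² ≤ L³ |ĉ₀(φ)|² + (L/2π)² ∫_{[0,L)³} |∇φ|²`;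
* `lintegral_cell_sub_mean_normSq_le` (Poincaré–Wirtinger form):
  `∫_{[0,L)³} |φ - ĉ₀(φ)|² ≤ (L/2π)² ∫_{[0,L)³} |∇φ|²`,
with `|∇φ|² = gradSqC φ` (`PeriodicBoseGasLocalization.lean`).

**`N` particles.** For a `C¹` function `Ψ : (ℝ³)^N → ℂ` that is `Lℤ³`-periodic in every particle
(`IsTorusPeriodic L Ψ`), with coefficients `ĉₙ(Ψ)`, `n ∈ ℤ^{3N}` (`configFourierCoeff`; the zeroth one
is the mean, `configFourierCoeff_zero`), the same argument with `tsum_sq_configFourierCoeff` and the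
momentum representation of the kinetic energy `tsum_sq_mul_sq_configFourierCoeff` gives
* `lintegral_cellN_normSq_le`: `∫_{[0,L)^{3N}} |Ψ|² ≤ L^{3N} |ĉ₀(Ψ)|² + (L/2π)² ∫_{[0,L)^{3N}} |∇Ψ|²`,
  i.e. `‖Ψ‖² - |⟨φ₀^{⊗N}, Ψ⟩|² ≤ (L/2π)² ⟨Ψ, -ΔΨ⟩` — the spectral gap `(2π/L)²` of the free kinetic
  energy above its constant ground state `φ₀^{⊗N} = L^{-3N/2}`;
* `lintegral_cellN_sub_mean_normSq_le`: `∫_{[0,L)^{3N}} |Ψ - ĉ₀(Ψ)|² ≤ (L/2π)² ∫_{[0,L)^{3N}} |∇Ψ|²`,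
with `|∇Ψ|² = kineticDensity Ψ` (`BoseEinsteinCondensation.lean`). `ℝ≥0∞`-valued cell integrals as
in `PeriodicBoseGas*.lean`; the constant `(L/2π)²` is sharp (plane waves `e^{2πi x_{1,1}/L}`).

## References

* [LiebLoss2001] E. H. Lieb, M. Loss, *Analysis*, 2nd ed., AMS (2001): §7.9 (Fourier
  characterisation of `‖∇f‖²`) and Thm. 8.11 (Poincaré inequalities).
* [LSSY2005] E. H. Lieb, R. Seiringer, J. P. Solovej, J. Yngvason, *The Mathematics of the Bose Gas
  and its Condensation* (2005): App. A (A.10) (kinetic energy `∑_p p² a†_p a_p` on the torus; the gap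
  above `p = 0` is `(2π/L)²`).
-/

noncomputable section

open MeasureTheory Filter Set WithLp Complex UnitAddTorus
open scoped ENNReal NNReal Topology ComplexConjugate

namespace Literature.MathematicalPhysics.QuantumManyBody.BoseGas

/-! ## One particle: the cell `[0,L)³` -/

section OneParticle

variable {L : ℝ}

/-! ### The gap of the non-zero modes -/

/-- **Every non-zero mode has `|2πn/L|² ≥ (2π/L)²`**: for `n ∈ ℤ³ ∖ {0}`,
`1 ≤ (L/2π)² · 4π² |n|² / L²`. [folklore] -/
theorem one_le_sq_mul_modeWeight (hL : 0 < L) {n : Fin 3 → ℤ} (hn : n ≠ 0) :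
    (1 : ℝ) ≤ (L / (2 * Real.pi)) ^ 2 * (4 * Real.pi ^ 2 * (∑ j, (n j : ℝ) ^ 2) / L ^ 2) := by
  obtain ⟨j, hj⟩ : ∃ j, n j ≠ 0 := Function.ne_iff.mp hn
  have hπ : 0 < Real.pi := Real.pi_pos
  have h1 : (1 : ℝ) ≤ (n j : ℝ) ^ 2 := by
    have h' : (1 : ℝ) ≤ |(n j : ℝ)| := by exact_mod_cast Int.one_le_abs hj
    nlinarith [abs_nonneg (n j : ℝ), sq_abs (n j : ℝ)]
  have hsum : (n j : ℝ) ^ 2 ≤ ∑ i, (n i : ℝ) ^ 2 :=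
    Finset.single_le_sum (f := fun i => (n i : ℝ) ^ 2) (fun i _ => sq_nonneg _) (Finset.mem_univ j)
  have hid : (L / (2 * Real.pi)) ^ 2 * (4 * Real.pi ^ 2 * (∑ i, (n i : ℝ) ^ 2) / L ^ 2) =
      ∑ i, (n i : ℝ) ^ 2 := by
    field_simp
    ring
  rw [hid]
  exact h1.trans hsum

/-- **The gap in coefficient space**: for any family of coefficients indexed by `ℤ³`,
`∑ₙ ‖cₙ‖² ≤ ‖c₀‖² + (L/2π)² ∑ₙ (4π²|n|²/L²) ‖cₙ‖²`. [folklore] -/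
theorem tsum_sq_le_sq_zero_add_modeWeight (hL : 0 < L) (c : (Fin 3 → ℤ) → ℂ) :
    ∑' n, (‖c n‖₊ : ℝ≥0∞) ^ 2 ≤ (‖c 0‖₊ : ℝ≥0∞) ^ 2 +
      ENNReal.ofReal ((L / (2 * Real.pi)) ^ 2) *
        ∑' n : Fin 3 → ℤ, ENNReal.ofReal (4 * Real.pi ^ 2 * (∑ j, (n j : ℝ) ^ 2) / L ^ 2) *
          (‖c n‖₊ : ℝ≥0∞) ^ 2 := by
  rw [ENNReal.tsum_eq_add_tsum_ite (0 : Fin 3 → ℤ), ← ENNReal.tsum_mul_left]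
  refine add_le_add le_rfl (ENNReal.tsum_le_tsum fun n => ?_)
  split_ifs with h
  · exact bot_le
  · rw [← mul_assoc, ← ENNReal.ofReal_mul (sq_nonneg _)]
    calc ((‖c n‖₊ : ℝ≥0∞) ^ 2) = 1 * (‖c n‖₊ : ℝ≥0∞) ^ 2 := (one_mul _).symm
      _ ≤ ENNReal.ofReal ((L / (2 * Real.pi)) ^ 2 *
            (4 * Real.pi ^ 2 * (∑ j, (n j : ℝ) ^ 2) / L ^ 2)) * (‖c n‖₊ : ℝ≥0∞) ^ 2 := by
          gcongr
          rw [← ENNReal.ofReal_one]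
          exact ENNReal.ofReal_le_ofReal (one_le_sq_mul_modeWeight hL h)

/-! ### The Poincaré–Wirtinger inequality on `[0,L)³` -/

/-- **Free-particle spectral gap on the torus (projection form of the Poincaré inequality).** For a
`C¹`, `Lℤ³`-periodic `φ : ℝ³ → ℂ`,
`∫_{[0,L)³} |φ|² ≤ L³ |ĉ₀(φ)|² + (L/2π)² ∫_{[0,L)³} |∇φ|²`, i.e.
`‖φ‖² - |⟨φ₀, φ⟩|² ≤ (L/2π)² ⟨φ, -Δφ⟩` with `φ₀ = L^{-3/2}` the constant mode.
[cite: LiebLoss2001, §7.9 and Thm. 8.11 (kinetic energy in Fourier space; Poincaré inequality)] -/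
theorem lintegral_cell_normSq_le (hL : 0 < L) {φ : Space → ℂ} (hφ : ContDiff ℝ 1 φ)
    (hper : ∀ (x : Space) (k : Fin 3), φ (x + EuclideanSpace.single k L) = φ x) :
    ∫⁻ x in cell L, (‖φ x‖₊ : ℝ≥0∞) ^ 2 ≤
      ENNReal.ofReal L ^ 3 * (‖cellFourierCoeff L φ 0‖₊ : ℝ≥0∞) ^ 2 +
        ENNReal.ofReal ((L / (2 * Real.pi)) ^ 2) * ∫⁻ x in cell L, gradSqC φ x := by
  set V : ℝ≥0∞ := ENNReal.ofReal L ^ 3 with hV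
  have hV0 : V ≠ 0 := pow_ne_zero _ (ENNReal.ofReal_pos.2 hL).ne'
  have hVtop : V ≠ ⊤ := ENNReal.pow_ne_top ENNReal.ofReal_ne_top
  have hVV : V * V⁻¹ = 1 := ENNReal.mul_inv_cancel hV0 hVtop
  have h := tsum_sq_le_sq_zero_add_modeWeight hL (cellFourierCoeff L φ)
  rw [tsum_sq_cellFourierCoeff hL hφ.continuous, tsum_sq_grad_cellFourierCoeff hL hφ hper] at h
  have h' : V * _ ≤ V * _ := mul_le_mul' le_rfl h
  rw [← mul_assoc, hVV, one_mul, mul_add, mul_left_comm, ← mul_assoc V, hVV, one_mul] at h'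
  exact h'

/-- Subtracting a constant does not change `|∇φ|²`. [folklore] -/
theorem gradSqC_sub_const (φ : Space → ℂ) (c : ℂ) (x : Space) :
    gradSqC (fun y => φ y - c) x = gradSqC φ x := by
  unfold gradSqC
  rw [show (fun y => φ y - c) = fun y => φ y + -c from rfl, fderiv_add_const]

/-- The mean of `φ - ĉ₀(φ)` vanishes: `ĉ₀(φ - ĉ₀(φ)) = 0` (continuous `φ`). [folklore] -/
theorem cellFourierCoeff_zero_sub_mean (hL : 0 < L) {φ : Space → ℂ} (hφ : Continuous φ) :
    cellFourierCoeff L (fun x => φ x - cellFourierCoeff L φ 0) 0 = 0 := by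
  have hV : (L ^ 3)⁻¹ * L ^ 3 = (1 : ℝ) := inv_mul_cancel₀ (pow_ne_zero _ hL.ne')
  have hvol : volume.real (cell L) = L ^ 3 := by
    rw [measureReal_def, volume_cell, ENNReal.toReal_pow, ENNReal.toReal_ofReal hL.le]
  rw [cellFourierCoeff_zero hL, integral_sub (integrableOn_cell hφ) (integrableOn_const (C := _)
      (by rw [volume_cell]; exact ENNReal.pow_ne_top ENNReal.ofReal_ne_top)),
    setIntegral_const, hvol, smul_sub, ← cellFourierCoeff_zero hL, smul_smul, hV, one_smul, sub_self]

/-- **Poincaré–Wirtinger inequality on the torus cell `[0,L)³`.** For a `C¹`, `Lℤ³`-periodic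
`φ : ℝ³ → ℂ` with mean `ĉ₀(φ) = L⁻³ ∫_{[0,L)³} φ`,
`∫_{[0,L)³} |φ - ĉ₀(φ)|² ≤ (L/2π)² ∫_{[0,L)³} |∇φ|²`.
[cite: LiebLoss2001, Thm. 8.11 (Poincaré inequality; here with the sharp torus constant)] -/
theorem lintegral_cell_sub_mean_normSq_le (hL : 0 < L) {φ : Space → ℂ} (hφ : ContDiff ℝ 1 φ)
    (hper : ∀ (x : Space) (k : Fin 3), φ (x + EuclideanSpace.single k L) = φ x) :
    ∫⁻ x in cell L, (‖φ x - cellFourierCoeff L φ 0‖₊ : ℝ≥0∞) ^ 2 ≤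
      ENNReal.ofReal ((L / (2 * Real.pi)) ^ 2) * ∫⁻ x in cell L, gradSqC φ x := by
  have hΦ : ContDiff ℝ 1 (fun x => φ x - cellFourierCoeff L φ 0) := hφ.sub contDiff_const
  have hΦper : ∀ (x : Space) (k : Fin 3), (fun x => φ x - cellFourierCoeff L φ 0)
      (x + EuclideanSpace.single k L) = (fun x => φ x - cellFourierCoeff L φ 0) x := fun x k => by
    simp only [hper x k]
  have h := lintegral_cell_normSq_le hL hΦ hΦper
  rw [cellFourierCoeff_zero_sub_mean hL hφ.continuous, nnnorm_zero, ENNReal.coe_zero,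
    zero_pow two_ne_zero, mul_zero, zero_add] at h
  simpa only [gradSqC_sub_const] using h

end OneParticle

/-! ## `N` particles: the cell `[0,L)^{3N}` -/

section NParticle

variable {N : ℕ} {L : ℝ}

/-! ### The zeroth mode -/

/-- `e_0 = 1`. [folklore] -/
theorem cellWaveN_zero (L : ℝ) (X : Config N) : cellWaveN L (0 : Fin N × Fin 3 → ℤ) X = 1 := by
  unfold cellWaveN
  rw [mFourier_zero]
  rfl

/-- **The zeroth coefficient is the mean**: `ĉ₀(Ψ) = L^{-3N} ∫_{[0,L)^{3N}} Ψ`. [folklore] -/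
theorem configFourierCoeff_zero (hL : 0 < L) {Ψ : Config N → ℂ}
    (hΨ : AEStronglyMeasurable Ψ (volume.restrict (cellN N L))) :
    configFourierCoeff L Ψ 0 = ((((L ^ 3)⁻¹) ^ N : ℝ)) • ∫ X in cellN N L, Ψ X := by
  rw [configFourierCoeff_eq_integral hL hΨ]
  simp only [cellWaveN_zero, map_one, one_mul]

/-- A continuous function is integrable on the cell `[0,L)^{3N}` (local copy of
`integrableOn_cellN_of_continuous` of `PeriodicFormSpectrum.lean`, not imported here). [folklore] -/
private theorem integrableOn_cellN_continuous_aux (L : ℝ) {E : Type*} [NormedAddCommGroup E]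
    {Ψ : Config N → E} (hΨ : Continuous Ψ) : IntegrableOn Ψ (cellN N L) volume :=
  (hΨ.continuousOn.integrableOn_compact (isCompact_closedBoxN N L)).mono_set
    (cellN_subset_closedBoxN N L)

/-- The real volume of the cell: `|[0,L)^{3N}| = (L³)^N`. [folklore] -/
theorem volume_real_cellN (hL : 0 < L) (N : ℕ) :
    volume.real (cellN N L) = (L ^ 3) ^ N := by
  rw [measureReal_def, volume_cellN, ENNReal.toReal_pow, ENNReal.toReal_pow,
    ENNReal.toReal_ofReal hL.le]

/-- Subtracting the mean kills the zeroth coefficient: `ĉ₀(Ψ - ĉ₀(Ψ)) = 0` (continuous `Ψ`).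
[folklore] -/
theorem configFourierCoeff_zero_sub_mean (hL : 0 < L) {Ψ : Config N → ℂ} (hΨ : Continuous Ψ) :
    configFourierCoeff L (fun X => Ψ X - configFourierCoeff L Ψ 0) 0 = 0 := by
  have hV : ((L ^ 3)⁻¹) ^ N * (L ^ 3) ^ N = (1 : ℝ) := by
    rw [← mul_pow, inv_mul_cancel₀ (pow_ne_zero _ hL.ne'), one_pow]
  have hc : Continuous fun X => Ψ X - configFourierCoeff L Ψ 0 := hΨ.sub continuous_const
  rw [configFourierCoeff_zero hL (Ψ := fun X => Ψ X - configFourierCoeff L Ψ 0) hc.aestronglyMeasurable,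
    integral_sub (integrableOn_cellN_continuous_aux L hΨ) (integrableOn_const (C := _)
      (by rw [volume_cellN]; exact ENNReal.pow_ne_top (ENNReal.pow_ne_top ENNReal.ofReal_ne_top))),
    setIntegral_const, volume_real_cellN hL, smul_sub, ← configFourierCoeff_zero hL
      hΨ.aestronglyMeasurable, smul_smul, hV, one_smul, sub_self]

/-! ### The gap of the non-zero modes -/

/-- **Every non-zero mode has `|2πn/L|² ≥ (2π/L)²`**: for `n ∈ ℤ^{3N} ∖ {0}`,
`1 ≤ (L/2π)² ∑_{i,k} (2π n_{i,k}/L)²`. [folklore] -/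
theorem one_le_sq_mul_sum_sq (hL : 0 < L) {n : Fin N × Fin 3 → ℤ} (hn : n ≠ 0) :
    (1 : ℝ) ≤ (L / (2 * Real.pi)) ^ 2 * ∑ p, (2 * Real.pi * (n p) / L) ^ 2 := by
  obtain ⟨p, hp⟩ : ∃ p, n p ≠ 0 := Function.ne_iff.mp hn
  have hπ : 0 < 2 * Real.pi := by positivity
  have h1 : (1 : ℝ) ≤ (n p : ℝ) ^ 2 := by
    have h := Int.one_le_abs hp
    have h' : (1 : ℝ) ≤ |(n p : ℝ)| := by exact_mod_cast h
    nlinarith [abs_nonneg (n p : ℝ), sq_abs (n p : ℝ)]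
  have hterm : (L / (2 * Real.pi)) ^ 2 * (2 * Real.pi * (n p) / L) ^ 2 = (n p : ℝ) ^ 2 := by
    field_simp
  calc (1 : ℝ) ≤ (n p : ℝ) ^ 2 := h1
    _ = (L / (2 * Real.pi)) ^ 2 * (2 * Real.pi * (n p) / L) ^ 2 := hterm.symm
    _ ≤ (L / (2 * Real.pi)) ^ 2 * ∑ q, (2 * Real.pi * (n q) / L) ^ 2 := by
        gcongr
        exact Finset.single_le_sum (f := fun q => (2 * Real.pi * (n q) / L) ^ 2)
          (fun q _ => sq_nonneg _) (Finset.mem_univ p)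

/-- **The gap in coefficient space**: for any family of coefficients,
`∑ₙ ‖cₙ‖² ≤ ‖c₀‖² + (L/2π)² ∑ₙ |2πn/L|² ‖cₙ‖²`. [folklore] -/
theorem tsum_sq_le_sq_zero_add (hL : 0 < L) (c : (Fin N × Fin 3 → ℤ) → ℂ) :
    ∑' n, (‖c n‖₊ : ℝ≥0∞) ^ 2 ≤ (‖c 0‖₊ : ℝ≥0∞) ^ 2 +
      ENNReal.ofReal ((L / (2 * Real.pi)) ^ 2) *
        ∑' n, ENNReal.ofReal (∑ p, (2 * Real.pi * (n p) / L) ^ 2) * (‖c n‖₊ : ℝ≥0∞) ^ 2 := by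
  rw [ENNReal.tsum_eq_add_tsum_ite (0 : Fin N × Fin 3 → ℤ), ← ENNReal.tsum_mul_left]
  refine add_le_add le_rfl (ENNReal.tsum_le_tsum fun n => ?_)
  split_ifs with h
  · exact bot_le
  · rw [← mul_assoc, ← ENNReal.ofReal_mul (sq_nonneg _)]
    calc ((‖c n‖₊ : ℝ≥0∞) ^ 2) = 1 * (‖c n‖₊ : ℝ≥0∞) ^ 2 := (one_mul _).symm
      _ ≤ ENNReal.ofReal ((L / (2 * Real.pi)) ^ 2 * ∑ p, (2 * Real.pi * (n p) / L) ^ 2) *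
            (‖c n‖₊ : ℝ≥0∞) ^ 2 := by
          gcongr
          rw [← ENNReal.ofReal_one]
          exact ENNReal.ofReal_le_ofReal (one_le_sq_mul_sum_sq hL h)

/-! ### The Poincaré–Wirtinger inequality on `[0,L)^{3N}` -/

/-- **Free-gas spectral gap (projection form of the Poincaré inequality on the torus).** For a `C¹`
`N`-body function that is `Lℤ³`-periodic in every particle,
`∫_{[0,L)^{3N}} |Ψ|² ≤ L^{3N} |ĉ₀(Ψ)|² + (L/2π)² ∫_{[0,L)^{3N}} |∇Ψ|²`, i.e.
`‖Ψ‖² - |⟨φ₀^{⊗N}, Ψ⟩|² ≤ (L/2π)² ⟨Ψ, -Δ Ψ⟩` with `φ₀^{⊗N} = L^{-3N/2}` the constant mode.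
[cite: LiebLoss2001, §7.9 and Thm. 8.11 (Fourier characterisation of the kinetic energy; Poincaré inequality)] -/
theorem lintegral_cellN_normSq_le (hL : 0 < L) {Ψ : Config N → ℂ} (hΨ : ContDiff ℝ 1 Ψ)
    (hper : IsTorusPeriodic L Ψ) :
    ∫⁻ X in cellN N L, (‖Ψ X‖₊ : ℝ≥0∞) ^ 2 ≤
      (ENNReal.ofReal L ^ 3) ^ N * (‖configFourierCoeff L Ψ 0‖₊ : ℝ≥0∞) ^ 2 +
        ENNReal.ofReal ((L / (2 * Real.pi)) ^ 2) * ∫⁻ X in cellN N L, kineticDensity Ψ X := by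
  set V : ℝ≥0∞ := (ENNReal.ofReal L ^ 3) ^ N with hV
  have hV0 : (ENNReal.ofReal L ^ 3) ≠ 0 := pow_ne_zero _ (ENNReal.ofReal_pos.2 hL).ne'
  have hVtop : (ENNReal.ofReal L ^ 3) ≠ ⊤ := ENNReal.pow_ne_top ENNReal.ofReal_ne_top
  have hVV : V * ((ENNReal.ofReal L ^ 3)⁻¹) ^ N = 1 := by
    rw [hV, ← mul_pow, ENNReal.mul_inv_cancel hV0 hVtop, one_pow]
  have h := tsum_sq_le_sq_zero_add hL (configFourierCoeff L Ψ)
  rw [tsum_sq_configFourierCoeff hL hΨ.continuous, tsum_sq_mul_sq_configFourierCoeff hL hΨ hper] at h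
  have h' : V * _ ≤ V * _ := mul_le_mul' le_rfl h
  rw [← mul_assoc, hVV, one_mul, mul_add, mul_left_comm, ← mul_assoc V, hVV, one_mul] at h'
  exact h'

/-- Subtracting a constant does not change the kinetic density. [folklore] -/
theorem kineticDensity_sub_const (Ψ : Config N → ℂ) (c : ℂ) (X : Config N) :
    kineticDensity (fun Y => Ψ Y - c) X = kineticDensity Ψ X := by
  unfold kineticDensity
  rw [show (fun Y => Ψ Y - c) = fun Y => Ψ Y + -c from rfl, fderiv_add_const]

/-- **Poincaré–Wirtinger inequality on the torus cell.** For a `C¹` `N`-body function that is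
`Lℤ³`-periodic in every particle, with mean `ĉ₀(Ψ) = L^{-3N} ∫_{[0,L)^{3N}} Ψ`,
`∫_{[0,L)^{3N}} |Ψ - ĉ₀(Ψ)|² ≤ (L/2π)² ∫_{[0,L)^{3N}} |∇Ψ|²`.
[cite: LiebLoss2001, Thm. 8.11 (Poincaré inequality; here with the sharp torus constant)] -/
theorem lintegral_cellN_sub_mean_normSq_le (hL : 0 < L) {Ψ : Config N → ℂ} (hΨ : ContDiff ℝ 1 Ψ)
    (hper : IsTorusPeriodic L Ψ) :
    ∫⁻ X in cellN N L, (‖Ψ X - configFourierCoeff L Ψ 0‖₊ : ℝ≥0∞) ^ 2 ≤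
      ENNReal.ofReal ((L / (2 * Real.pi)) ^ 2) * ∫⁻ X in cellN N L, kineticDensity Ψ X := by
  have hΦ : ContDiff ℝ 1 (fun X => Ψ X - configFourierCoeff L Ψ 0) := hΨ.sub contDiff_const
  have hΦper : IsTorusPeriodic L (fun X => Ψ X - configFourierCoeff L Ψ 0) := fun X i k => by
    simp only [hper X i k]
  have h := lintegral_cellN_normSq_le hL hΦ hΦper
  rw [configFourierCoeff_zero_sub_mean hL hΨ.continuous, nnnorm_zero, ENNReal.coe_zero,
    zero_pow two_ne_zero, mul_zero, zero_add] at h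
  simpa only [kineticDensity_sub_const] using h

end NParticle

end Literature.MathematicalPhysics.QuantumManyBody.BoseGas

end
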